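import Mathlib
import HarnessLib
import Summits.QuantumFields.YangMills.Theses.ConvexGribovBody
import Summits.QuantumFields.YangMills.Theses.EquipartitionCriticality
import Summits.QuantumFields.YangMills.Theses.DirichletWindow

/-!
# Stub `stub_criticality` of line `Sketch` (crux `ContinuumLegGivenGap`, stmt-QuantumFields-8782)

Registered signature (skeleton `Cruxes/ContinuumLegGivenGap/Lines/Sketch.lean`):
`theorem stub_criticality : Criticality`, with

* `Criticality := ∀ G [compact simple, any Borel structure] r, GapHypAt G r → AdmissibleRatesVanish G r`.

This work file records what CAN be kernel-checked about the stub (all `sorry`-free):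

1. `criticality_iff_admissibleRatesVanish` — the extra hypothesis `GapHypAt G r` is logically idle:
   an admissible rate function is itself a witness of `GapHypAt`, so on `¬ GapHypAt` the conclusion
   is vacuous; hence the stub is EXACTLY "hypothesis (2) of stmt-8762 at every compact simple `(G, r)`".
2. `criticality_iff_borel` — the stub (arbitrary `[MeasurableSpace G] [BorelSpace G]`) is equivalent
   to its `borel G` instance form (transport along `BorelSpace.measurable_eq`), which is the form in
   which the theses `EquipartitionCriticality` / `DirichletWindow` state their items.
3. `criticalityOfXiDiverges_iff` — stmt-QuantumFields-12318 `DirichletWindow.CriticalityOfXiDiverges`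
   IS, up to this transport, the implication `XiDiverges (stmt-8941) → Criticality`.
4. The two conditional derivations from existing (UNPROVED) route items:
   `criticality_of_xi` (8941 + 12318) and `criticality_of_equipartition` (8759 + 8760 + 8763).

No unconditional proof exists in the tree: the stub asserts divergence of the lattice correlation
length of 4-d Wilson lattice gauge theory at `β = ∞` for every compact simple `G` (Chatterjee,
arXiv:1803.01950, Problem 5.1, open; tree `Literature.MathematicalPhysics.QuantumFieldTheory.LatticeMassGapAllCouplings`
is a registered open conjecture, not a theorem).
-/

noncomputable section

namespace Summit.QuantumFields.YangMills.Cruxes.ContinuumLegGivenGap.Sketch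

open Filter
open Literature.MathematicalPhysics.QuantumFieldTheory
open Summit.QuantumFields.YangMills.Theses

/-! ## §0 Vocabulary — verbatim copies of the skeleton-local definitions (not importable) -/

variable {G : Type} [Group G] [TopologicalSpace G] [IsTopologicalGroup G] [CompactSpace G]
  [MeasurableSpace G] [BorelSpace G]

variable (G) in
/-- The crux's hypothesis at one `(G, r)` (verbatim from the skeleton). [folklore] -/
def GapHypAt (r : LatticeRep G) : Prop :=
  ∃ β₀ : ℝ, ∀ β : ℝ, β₀ ≤ β → ∃ m : ℝ, 0 < m ∧ ∃ S₁ : ℕ, ∀ A B : YMSpecies G, ∃ C : ℝ,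
    ∀ S n : ℕ, S₁ ≤ S → n ≤ S →
      |latticeConnectedCorr r.ρ β (2 * S + 1) A.F B.F n| ≤ C * Real.exp (-(m * n))

variable (G) in
/-- Hypothesis (2) of `CriticalContinuumLimit` (stmt-8762) at one `(G, r)` (verbatim from the
skeleton). [folklore] -/
def AdmissibleRatesVanish (r : LatticeRep G) : Prop :=
  ∀ (β₁ : ℝ) (m : ℝ → ℝ),
    (∀ β : ℝ, β₁ ≤ β → 0 < m β ∧ (∃ S₀ : ℕ, ∀ A B : YMSpecies G, ∃ C : ℝ, ∀ S n : ℕ, S₀ ≤ S →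
      n ≤ S → |latticeConnectedCorr r.ρ β (2 * S + 1) A.F B.F n| ≤ C * Real.exp (-(m β * n)))) →
    ∀ m₀ : ℝ, 0 < m₀ → ∀ᶠ β : ℝ in atTop, m β < m₀

/-- **(N) Criticality at `β = ∞`** — the statement of `stub_criticality` (verbatim from the
skeleton). [folklore] -/
def Criticality : Prop :=
  ∀ (G : Type) [Group G] [TopologicalSpace G] [IsTopologicalGroup G] [CompactSpace G]
    [MeasurableSpace G] [BorelSpace G], IsCompactSimpleLieGroup G →
    ∀ r : LatticeRep G, GapHypAt G r → AdmissibleRatesVanish G r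

/-- The `borel G` instance form of the stub (the form in which the theses state their items),
WITHOUT the idle hypothesis `GapHypAt`. [folklore] -/
def CriticalityBorel : Prop :=
  ∀ (G : Type) [Group G] [TopologicalSpace G] [IsTopologicalGroup G] [CompactSpace G],
    IsCompactSimpleLieGroup G →
      letI : MeasurableSpace G := borel G
      haveI : BorelSpace G := ⟨rfl⟩
      ∀ r : LatticeRep G, AdmissibleRatesVanish G r

/-! ## §1 The hypothesis `GapHypAt` is idle -/

/-- An admissible rate function on `[β₁, ∞)` is a witness of `GapHypAt` (with `β₀ := β₁`,
per-β rate `m β`, threshold `S₀(β)`). [folklore] -/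
theorem gapHypAt_of_admissible (r : LatticeRep G) (β₁ : ℝ) (m : ℝ → ℝ)
    (hm : ∀ β : ℝ, β₁ ≤ β → 0 < m β ∧ (∃ S₀ : ℕ, ∀ A B : YMSpecies G, ∃ C : ℝ, ∀ S n : ℕ, S₀ ≤ S →
      n ≤ S → |latticeConnectedCorr r.ρ β (2 * S + 1) A.F B.F n| ≤ C * Real.exp (-(m β * n)))) :
    GapHypAt G r :=
  ⟨β₁, fun β hβ => ⟨m β, (hm β hβ).1, hm β hβ |>.2⟩⟩

/-- On `¬ GapHypAt` the conclusion `AdmissibleRatesVanish` holds vacuously. [folklore] -/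
theorem admissibleRatesVanish_of_not_gapHypAt (r : LatticeRep G) (h : ¬ GapHypAt G r) :
    AdmissibleRatesVanish G r :=
  fun β₁ m hm => absurd (gapHypAt_of_admissible r β₁ m hm) h

/-- **The stub is exactly "hypothesis (2) of stmt-8762 at every compact simple `(G, r)`"**: the
hypothesis `GapHypAt G r` can be dropped. [folklore] -/
theorem criticality_iff_admissibleRatesVanish :
    Criticality ↔
      ∀ (G : Type) [Group G] [TopologicalSpace G] [IsTopologicalGroup G] [CompactSpace G]
        [MeasurableSpace G] [BorelSpace G], IsCompactSimpleLieGroup G →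
        ∀ r : LatticeRep G, AdmissibleRatesVanish G r := by
  constructor
  · intro h G _ _ _ _ _ _ hG r
    by_cases hgap : GapHypAt G r
    · exact h G hG r hgap
    · exact admissibleRatesVanish_of_not_gapHypAt r hgap
  · intro h G _ _ _ _ _ _ hG r _
    exact h G hG r

/-! ## §2 Transport between an arbitrary Borel structure and `borel G` -/

/-- **The stub is equivalent to its `borel G` instance form** (transport along
`BorelSpace.measurable_eq`). [folklore] -/
theorem criticality_iff_borel : Criticality ↔ CriticalityBorel := by
  rw [criticality_iff_admissibleRatesVanish]
  constructor
  · intro h G _ _ _ _ hG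
    letI : MeasurableSpace G := borel G
    haveI : BorelSpace G := ⟨rfl⟩
    exact h G hG
  · intro h G _ _ _ _ _ hB hG r
    obtain ⟨hB⟩ := hB
    subst hB
    exact h G hG r

/-! ## §3 stmt-12318 is `XiDiverges → stub`; the two conditional derivations -/

omit [Group G] [TopologicalSpace G] [IsTopologicalGroup G] [CompactSpace G] [MeasurableSpace G]
  [BorelSpace G] in
/-- **stmt-QuantumFields-12318 read back**: `DirichletWindow.CriticalityOfXiDiverges` is literally
the implication `DirichletWindow.XiDiverges → Criticality` (up to the Borel transport). [folklore] -/
theorem criticalityOfXiDiverges_iff :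
    DirichletWindow.CriticalityOfXiDiverges ↔ (DirichletWindow.XiDiverges → Criticality) := by
  constructor
  · intro h hXi
    exact criticality_iff_borel.2 fun G _ _ _ _ hG r => h hXi G hG r
  · intro h hXi G _ _ _ _ hG r
    exact criticality_iff_borel.1 (h hXi) G hG r

omit [Group G] [TopologicalSpace G] [IsTopologicalGroup G] [CompactSpace G] [MeasurableSpace G]
  [BorelSpace G] in
/-- **Supplier chain A** (route `DirichletWindow`): `XiDiverges` (stmt-8941, open-problem) +
`CriticalityOfXiDiverges` (stmt-12318, glue) ⊢ the stub. [folklore] -/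
theorem criticality_of_xi (h41 : DirichletWindow.XiDiverges)
    (h18 : DirichletWindow.CriticalityOfXiDiverges) : Criticality :=
  criticalityOfXiDiverges_iff.1 h18 h41

omit [Group G] [TopologicalSpace G] [IsTopologicalGroup G] [CompactSpace G] [MeasurableSpace G]
  [BorelSpace G] in
/-- **Supplier chain B** (route `EquipartitionCriticality`): `FreeEnergyLogCoefficient` (stmt-8759) +
`EquipartitionPinsProbe` (stmt-8760) + `RPProbeCriticality` (stmt-8763) ⊢ the stub. [folklore] -/
theorem criticality_of_equipartition (h59 : EquipartitionCriticality.FreeEnergyLogCoefficient)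
    (h60 : EquipartitionCriticality.EquipartitionPinsProbe)
    (h63 : EquipartitionCriticality.RPProbeCriticality) : Criticality :=
  criticality_iff_borel.2 fun G _ _ _ _ hG r => h63 G hG r (h60 G hG r (h59 G hG r))

omit [Group G] [TopologicalSpace G] [IsTopologicalGroup G] [CompactSpace G] [MeasurableSpace G]
  [BorelSpace G] in
/-- Conversely the stub supplies hypothesis (2) of the hub `CriticalContinuumLimit` (stmt-8762) in
the hub's own (`borel G`) form, for every compact simple `G` and every `r`. [folklore] -/
theorem hub_hypothesis_two_of_criticality (h : Criticality) (G : Type) [Group G] [TopologicalSpace G]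
    [IsTopologicalGroup G] [CompactSpace G] (hG : IsCompactSimpleLieGroup G) :
    letI : MeasurableSpace G := borel G
    haveI : BorelSpace G := ⟨rfl⟩
    ∀ r : LatticeRep G, AdmissibleRatesVanish G r :=
  criticality_iff_borel.1 h G hG

/-! ## §4 The registered signature with bodies expanded (tree-nameable form), from either chain -/

omit [Group G] [TopologicalSpace G] [IsTopologicalGroup G] [CompactSpace G] [MeasurableSpace G]
  [BorelSpace G] in
/-- **`stub_criticality` from either existing supplier chain, bodies expanded** (this is the exact
registered signature with `Criticality`, `GapHypAt`, `AdmissibleRatesVanish` unfolded; it is the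
second hypothesis of the landed `Theorems.ContinuumLegGivenGap.stub_dock`). Conditional on UNPROVED
items: chain A = stmt-8941 ∧ stmt-12318, chain B = stmt-8759 ∧ stmt-8760 ∧ stmt-8763. [folklore] -/
theorem stub_criticality_of_suppliers
    (h : (DirichletWindow.XiDiverges ∧ DirichletWindow.CriticalityOfXiDiverges) ∨
      (EquipartitionCriticality.FreeEnergyLogCoefficient ∧
        EquipartitionCriticality.EquipartitionPinsProbe ∧ EquipartitionCriticality.RPProbeCriticality)) :
    ∀ (G : Type) [Group G] [TopologicalSpace G] [IsTopologicalGroup G] [CompactSpace G]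
      [MeasurableSpace G] [BorelSpace G], IsCompactSimpleLieGroup G → ∀ r : LatticeRep G,
      (∃ β₀ : ℝ, ∀ β : ℝ, β₀ ≤ β → ∃ m : ℝ, 0 < m ∧ ∃ S₁ : ℕ, ∀ A B : YMSpecies G, ∃ C : ℝ,
        ∀ S n : ℕ, S₁ ≤ S → n ≤ S →
          |latticeConnectedCorr r.ρ β (2 * S + 1) A.F B.F n| ≤ C * Real.exp (-(m * n))) →
      ∀ (β₁ : ℝ) (m : ℝ → ℝ),
        (∀ β : ℝ, β₁ ≤ β → 0 < m β ∧ (∃ S₀ : ℕ, ∀ A B : YMSpecies G, ∃ C : ℝ, ∀ S n : ℕ,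
          S₀ ≤ S → n ≤ S →
            |latticeConnectedCorr r.ρ β (2 * S + 1) A.F B.F n| ≤ C * Real.exp (-(m β * n)))) →
        ∀ m₀ : ℝ, 0 < m₀ → ∀ᶠ β : ℝ in atTop, m β < m₀ := by
  rcases h with ⟨h41, h18⟩ | ⟨h59, h60, h63⟩
  · exact criticality_of_xi h41 h18
  · exact criticality_of_equipartition h59 h60 h63

/-- Sanity read-back: the expanded form above IS `Criticality` (definitional). [folklore] -/
example : Criticality ↔
    ∀ (G : Type) [Group G] [TopologicalSpace G] [IsTopologicalGroup G] [CompactSpace G]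
      [MeasurableSpace G] [BorelSpace G], IsCompactSimpleLieGroup G → ∀ r : LatticeRep G,
      (∃ β₀ : ℝ, ∀ β : ℝ, β₀ ≤ β → ∃ m : ℝ, 0 < m ∧ ∃ S₁ : ℕ, ∀ A B : YMSpecies G, ∃ C : ℝ,
        ∀ S n : ℕ, S₁ ≤ S → n ≤ S →
          |latticeConnectedCorr r.ρ β (2 * S + 1) A.F B.F n| ≤ C * Real.exp (-(m * n))) →
      ∀ (β₁ : ℝ) (m : ℝ → ℝ),
        (∀ β : ℝ, β₁ ≤ β → 0 < m β ∧ (∃ S₀ : ℕ, ∀ A B : YMSpecies G, ∃ C : ℝ, ∀ S n : ℕ,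
          S₀ ≤ S → n ≤ S →
            |latticeConnectedCorr r.ρ β (2 * S + 1) A.F B.F n| ≤ C * Real.exp (-(m β * n)))) →
        ∀ m₀ : ℝ, 0 < m₀ → ∀ᶠ β : ℝ in atTop, m β < m₀ :=
  Iff.rfl

end Summit.QuantumFields.YangMills.Cruxes.ContinuumLegGivenGap.Sketch

end
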